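import Mathlib
import Summits.Ventures.PercRepro2.Defs
import Summits.Ventures.PercRepro2.Graph
import Summits.Ventures.PercRepro2.OneColourSwitch
import Summits.Ventures.PercRepro2.RegionHubSign
import Summits.Ventures.PercRepro2.SideSwitch
import Summits.Ventures.PercRepro2.M9NoPocketDefs
import Summits.Ventures.PercRepro2.M9NoPocketWorldD
import Summits.Ventures.PercRepro2.M9SubcubeHarris
import Summits.Ventures.PercRepro2.M9ClusterFibreHarris
import Summits.Ventures.PercRepro2.M9ClusterAvoidHarris
import Summits.Ventures.PercRepro2.M9PocketUnitFibre
import Summits.Ventures.PercRepro2.M9PocketUnitFibreSum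

/-!
# The exploration fibre without the «no `T`-edge» hypothesis (blind cell PercRepro2, p3 g39,
2026-08-29; `proofs/P3-POCKETRK.md` §10‴ step (2))

The fibre lemmas of `M9PocketUnitFibreSum` that used «no `d r`, `d s` edge» used it only to
exclude a `W` edge from `r` or `s` to `d`; on a base point with `d ∉ M₂` such an edge is `Y`.
So the `W`-cluster of `r` is `{r}` on the fibre (`cluster_compl_mark_eq_singleton_T`), `M₂ = {r, s}`
(`mem_M2_iff_on_unitFibre_T`), `Sep` and `σ_rs` are those of the base point, `DOne` holds, and
`σ_rs ≥ 0` — with `hM : d ∉ M₂` in place of `hT`.  The `T`-edge chain: the variants carry the suffix `_T`.  Own work; std axioms.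
-/

namespace Summit.Ventures.PercRepro2

namespace NoPocket

open Finset Classical OneColourSwitch SideSwitch

variable {V : Type*} {E : Type*} {ends : E → Sym2 V} {p q r s d : V} {ω₀ : Config E}

/-- **The `W`-cluster of `r` (or `s`) is `{r}` (`{s}`)** on the fibre of a colouring without a
`W`-side with `d ∉ M₂`, no edge inside `{r, s}`: every edge at `r` is open (a `W` edge to `d`
would put `d` in `M₂`; `T`-edges allowed). -/
lemma cluster_compl_mark_eq_singleton_T (hdr : d ≠ r) (hds : d ≠ s)
    (hrs : within ends ({r, s} : Set V) = ∅) (hM : d ∉ M2 ends r s ω₀)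
    (hB : ∀ x ∈ M2 (endsD ends d) r s ω₀, x = r ∨ x = s) {ω : Config E}
    (hω : ∀ e ∈ touches ends (cluster ends ω₀ d ∪ K2 (endsD ends d) r s ω₀ ∪
      M2 (endsD ends d) r s ω₀), ω e = ω₀ e) {t : V} (ht : t = r ∨ t = s) :
    cluster ends (OneColourSwitch.compl ω) t = {t} := by
  have htU : t ∈ cluster ends ω₀ d ∪ K2 (endsD ends d) r s ω₀ ∪ M2 (endsD ends d) r s ω₀ := by
    rcases ht with rfl | rfl
    · exact Or.inl (Or.inr (r_mem_K2 t s ω₀))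
    · exact Or.inl (Or.inr (s_mem_K2 r t ω₀))
  have htd : t ≠ d := by
    rcases ht with rfl | rfl
    · exact hdr.symm
    · exact hds.symm
  ext y
  simp only [Set.mem_singleton_iff, mem_cluster]
  constructor
  · intro hy
    have key : y ∈ {z | z = t} := by
      refine mem_of_conn_of_closed (ends := ends) (ω := OneColourSwitch.compl ω) ?_ rfl hy
      rintro a ha b hab
      simp only [Set.mem_setOf_eq] at ha ⊢
      subst ha
      exfalso
      obtain ⟨hne, e, he, hends⟩ := openGraph_adj.1 hab
      have he₀ : ω₀ e = false := by
        have := hω e (mem_touches_of_ends hends (Or.inl htU))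
        simp only [OneColourSwitch.compl, Bool.not_eq_true'] at he
        rw [← this]; exact he
      -- `b ≠ r, s` (no edge inside `{r, s}`), `b ≠ d` (no `T`-edge)
      have hbrs : ¬ (b = r ∨ b = s) := by
        intro hb
        have : e ∈ within ends ({r, s} : Set V) := by
          refine ⟨a, ?_, b, ?_, hends⟩
          · rcases ht with rfl | rfl <;> simp
          · rcases hb with rfl | rfl <;> simp
        rw [hrs] at this
        exact this
      have hbd : b ≠ d := by
        rintro rfl
        refine hM (mem_M2_of_closed ?_ he₀ hends)
        rcases ht with rfl | rfl
        · exact r_mem_M2 a s ω₀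
        · exact s_mem_M2 r a ω₀
      -- then `b ∈ M₂(G − d)` by the closed edge from `a ∈ {r, s}`
      have hde : d ∉ ends e := notMem_of_ends_ne hends htd hbd
      have hbM : b ∈ M2 (endsD ends d) r s ω₀ := by
        have haM : a ∈ M2 (endsD ends d) r s ω₀ := by
          rcases ht with rfl | rfl
          · exact r_mem_M2 a s ω₀
          · exact s_mem_M2 r a ω₀
        exact mem_M2_of_closed haM he₀ (by rw [endsD_of_notMem hde, hends])
      exact hbrs (hB b hbM)
    exact key
  · rintro rfl
    exact conn_refl _ _ _

/-- On the fibre the `W`-world of `{r, s}` in `G` is `{r, s}`. -/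
lemma mem_M2_iff_on_unitFibre_T (hdr : d ≠ r) (hds : d ≠ s)
    (hrs : within ends ({r, s} : Set V) = ∅) (hM : d ∉ M2 ends r s ω₀)
    (hB : ∀ x ∈ M2 (endsD ends d) r s ω₀, x = r ∨ x = s) {ω : Config E}
    (hω : ∀ e ∈ touches ends (cluster ends ω₀ d ∪ K2 (endsD ends d) r s ω₀ ∪
      M2 (endsD ends d) r s ω₀), ω e = ω₀ e) {x : V} :
    x ∈ M2 ends r s ω ↔ x = r ∨ x = s := by
  rw [mem_M2_iff, ← mem_cluster, ← mem_cluster,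
    cluster_compl_mark_eq_singleton_T hdr hds hrs hM hB hω (Or.inl rfl),
    cluster_compl_mark_eq_singleton_T hdr hds hrs hM hB hω (Or.inr rfl)]
  simp

/-- On the fibre `Sep` is that of `ω₀`. -/
lemma sep2_iff_on_unitFibre_T (hdr : d ≠ r) (hds : d ≠ s)
    (hrs : within ends ({r, s} : Set V) = ∅) (hM : d ∉ M2 ends r s ω₀)
    (hB : ∀ x ∈ M2 (endsD ends d) r s ω₀, x = r ∨ x = s) {ω : Config E}
    (hω : ∀ e ∈ touches ends (cluster ends ω₀ d ∪ K2 (endsD ends d) r s ω₀ ∪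
      M2 (endsD ends d) r s ω₀), ω e = ω₀ e) :
    sep2 ends p q r s ω ↔ sep2 ends p q r s ω₀ := by
  have h0 : ∀ e ∈ touches ends (cluster ends ω₀ d ∪ K2 (endsD ends d) r s ω₀ ∪
      M2 (endsD ends d) r s ω₀), ω₀ e = ω₀ e := fun _ _ => rfl
  rw [sep2_iff, sep2_iff, K2_eq_on_unitFibre hdr hds hB hω,
    mem_M2_iff_on_unitFibre_T hdr hds hrs hM hB hω, mem_M2_iff_on_unitFibre_T hdr hds hrs hM hB hω,
    mem_M2_iff_on_unitFibre_T hdr hds hrs hM hB h0, mem_M2_iff_on_unitFibre_T hdr hds hrs hM hB h0]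

/-- On the fibre `DOne` holds: the `W`-world of `{r, s}` is `{r, s}`. -/
lemma DOne_on_unitFibre_T (hdr : d ≠ r) (hds : d ≠ s)
    (hrs : within ends ({r, s} : Set V) = ∅) (hM : d ∉ M2 ends r s ω₀)
    (hB : ∀ x ∈ M2 (endsD ends d) r s ω₀, x = r ∨ x = s) {ω : Config E}
    (hω : ∀ e ∈ touches ends (cluster ends ω₀ d ∪ K2 (endsD ends d) r s ω₀ ∪
      M2 (endsD ends d) r s ω₀), ω e = ω₀ e) :
    DOne ends r s d ω := by
  intro x hxr hxs _ _ hxM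
  rcases (mem_M2_iff_on_unitFibre_T hdr hds hrs hM hB hω).1 hxM with h | h
  · exact hxr h
  · exact hxs h

/-- On the fibre `d ∉ M₂`. -/
lemma d_notMem_M2_on_unitFibre_T (hdr : d ≠ r) (hds : d ≠ s)
    (hrs : within ends ({r, s} : Set V) = ∅) (hM : d ∉ M2 ends r s ω₀)
    (hB : ∀ x ∈ M2 (endsD ends d) r s ω₀, x = r ∨ x = s) {ω : Config E}
    (hω : ∀ e ∈ touches ends (cluster ends ω₀ d ∪ K2 (endsD ends d) r s ω₀ ∪
      M2 (endsD ends d) r s ω₀), ω e = ω₀ e) :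
    d ∉ M2 ends r s ω := by
  intro h
  rcases (mem_M2_iff_on_unitFibre_T hdr hds hrs hM hB hω).1 h with h | h
  · exact hdr h
  · exact hds h

/-- On the fibre `σ_rs` is that of `ω₀`. -/
lemma sigma_rs_eq_on_unitFibre_T (hdr : d ≠ r) (hds : d ≠ s)
    (hrs : within ends ({r, s} : Set V) = ∅) (hM : d ∉ M2 ends r s ω₀)
    (hB : ∀ x ∈ M2 (endsD ends d) r s ω₀, x = r ∨ x = s) {ω : Config E}
    (hω : ∀ e ∈ touches ends (cluster ends ω₀ d ∪ K2 (endsD ends d) r s ω₀ ∪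
      M2 (endsD ends d) r s ω₀), ω e = ω₀ e) :
    sigma ends ω r s = sigma ends ω₀ r s := by
  have h0 : ∀ e ∈ touches ends (cluster ends ω₀ d ∪ K2 (endsD ends d) r s ω₀ ∪
      M2 (endsD ends d) r s ω₀), ω₀ e = ω₀ e := fun _ _ => rfl
  have hY : Conn ends ω r s ↔ Conn ends ω₀ r s := by
    rw [← mem_cluster, ← mem_cluster,
      cluster_eq_on_unitFibre hdr hds hB hω (z := r) (Or.inl (Or.inr (r_mem_K2 r s ω₀)))]
  have hW : Conn ends (OneColourSwitch.compl ω) r s ↔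
      Conn ends (OneColourSwitch.compl ω₀) r s := by
    rw [← mem_cluster, ← mem_cluster,
      cluster_compl_mark_eq_singleton_T hdr hds hrs hM hB hω (Or.inl rfl),
      cluster_compl_mark_eq_singleton_T hdr hds hrs hM hB h0 (Or.inl rfl)]
  simp only [sigma, hY, hW]

/-- `σ_rs ≥ 0` on a colouring without a `W`-side with `d ∉ M₂`, no edge inside `{r, s}`. -/
lemma sigma_rs_nonneg_of_noWside_T (hdr : d ≠ r) (hds : d ≠ s)
    (hrs : within ends ({r, s} : Set V) = ∅) (hM : d ∉ M2 ends r s ω₀)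
    (hB : ∀ x ∈ M2 (endsD ends d) r s ω₀, x = r ∨ x = s) :
    0 ≤ sigma ends ω₀ r s := by
  have h0 : ∀ e ∈ touches ends (cluster ends ω₀ d ∪ K2 (endsD ends d) r s ω₀ ∪
      M2 (endsD ends d) r s ω₀), ω₀ e = ω₀ e := fun _ _ => rfl
  have hW : Conn ends (OneColourSwitch.compl ω₀) r s ↔ s = r := by
    rw [← mem_cluster, cluster_compl_mark_eq_singleton_T hdr hds hrs hM hB h0 (Or.inl rfl)]
    simp
  simp only [sigma]
  by_cases hsr : s = r
  · subst hsr
    rw [if_pos (conn_refl _ _ _), if_pos (conn_refl _ _ _)]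
    norm_num
  · rw [if_neg (fun h => hsr (hW.1 h))]
    split_ifs <;> norm_num

end NoPocket

end Summit.Ventures.PercRepro2
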